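import Literature.Analysis.FluidPDE.LeiZhang2017AxisymmetricCriteria
import Literature.Analysis.FluidPDE.AxisymmetricNoSwirlGlobal
import Literature.Analysis.FluidPDE.CheskidovShvydkoyRegularProofs
import Literature.Analysis.FluidPDE.NSCriticalClosureTao
import Literature.Analysis.FluidPDE.TaoLocalisation
import Literature.Analysis.FluidPDE.SerrinEnstrophyGronwall
import HarnessLib

/-!
# Lei–Zhang 2017, Thm. 1.4 (small swirl): the continuation end-game

Analysis/FluidPDE proof file (all results proved, no definitions, no named facts) on the
decomposition path of the named fact
`Literature.Analysis.FluidPDE.LeiZhang2017_smallSwirl_regularity`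
(`LeiZhang2017AxisymmetricCriteria.lean`; Z. Lei, Q. S. Zhang, *Criticality of the axially
symmetric Navier–Stokes equations*, Pacific J. Math. 289 (2017) 169–187 = arXiv:1505.02628,
Thm. 1.4, first alternative).

The printed proof of Thm. 1.4 (§4, arXiv p. 10) is an **a-priori estimate** — under
`‖Γ₀‖_{L^∞} ≤ δ M₀⁻¹` the quantity `‖|V|²‖²_{L²} + ‖Ω‖²_{L²}` (`V = v^θ/√r`, `Ω = ω^θ/r`) does
not increase — followed by the words "The above argument implies, by the standard continuation
method […] Hence the proof for first part of the theorem is finished", i.e. by the end-game of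
§3 (arXiv p. 9): "`v ∈ L^∞_T(L⁴_x)`. So Serrin type criterion implies that `v` is regular up to
time `T`", combined with the local strong theory quoted at the start of §3 (Leray, Fujita–Kato)
and the identification of the given solution with the strong one.

This file formalises exactly that end-game in the tree's vocabulary, reducing the named fact to
its analytic heart, an a-priori bound in Tao's smooth class `IsTaoSolutionOn`
(`TaoClassGlue.lean`), with the a-priori bound as an explicit hypothesis (no named fact is
introduced):

* `exists_isTaoSolutionOn_of_enstrophy_apriori` — **the standard continuation method**: if all
  Tao-class solutions from a smooth divergence-free `H^∞` datum `u₀` on sub-slabs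
  `[0, T'] ⊆ [0, T]` obey `∫ ‖Du(t)‖² ≤ K`, then there is a Tao-class solution from `u₀` on
  `[0, T]` (Tao's local theory `tao2011_smooth_local_existence_holds` with its `H¹`-controlled
  lifespan, restart at `F − τ/2`, gluing by Prodi–Serrin `IsTaoSolutionOn.glue`; the proof of
  `exists_isTaoSolutionOn_of_noSwirl` with the symmetry-specific bound replaced by a hypothesis);
* `enstrophy_le_of_eLpNorm_four_le` — **"Serrin type criterion"** in a-priori form: a uniform
  `L⁴` bound `‖u(t)‖_{L⁴} ≤ N` on a Tao-class slab gives the enstrophy bound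
  `∫ |∇u(s)|²_F ≤ exp(C T N⁸) ∫ |∇u₀|²_F` (the tree's `serrin_enstrophy_bound` with `r = 4`,
  `q = 8`, Lemarié-Rieusset 2016, Thm. 11.2);
* `LeiZhang2017_smallSwirl_regularity_of_enstrophy_apriori` and
  `LeiZhang2017_smallSwirl_regularity_of_L4_apriori` — the named fact from the a-priori
  `H¹`- (resp. `L⁴`-) bound for Tao-class solutions from data satisfying the hypotheses of
  Thm. 1.4: march to `[0, T + 1]`, identify with the given classical Leray–Hopf solution on
  `[0, T)` by the proved Prodi–Serrin weak–strong uniqueness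
  (`eq_restart_of_serrin serrin_weak_strong_uniqueness_holds`), and read off
  `HasSmoothExtensionPast 1 0 u T`.

What remains for `LeiZhang2017_smallSwirl_regularity_holds` is the `L⁴` a-priori bound itself
(Lei–Zhang §4 (7-1)–(7-3) with Lemma 2.1, the maximum principle for `Γ`, and the `ω^θ`-estimate
of §3), to be proved in sibling files.

## Mathlib / tree search

Tree: `IsTaoSolutionOn.of_tao/.glue/.mono/.slice/.lintegral_enorm_sq_le/.isAxisymmetric`
(`TaoClassGlue`, `AxisymmetricNoSwirlGlobal`), `tao2011_smooth_local_existence_holds`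
(`CheskidovShvydkoyRegularProofs`), `eq_restart_of_serrin`, `serrin_weak_strong_uniqueness_holds`
(`NSCriticalClosureTao`, `NSSerrinUniqueness`), `serrin_enstrophy_bound`
(`SerrinEnstrophyGronwall`), `HasRapidSpatialDecay.lintegral_enorm_iteratedFDeriv_sq_lt_top`
(`TaoLocalisation`), `enorm_sq_fderiv_le_ofReal_frobeniusNormSq` (`EnstrophyGronwall`).
`lean search 'of_enstrophy_apriori|LeiZhang.*holds'`: nothing before this file.

## References

* Z. Lei, Q. S. Zhang, Pacific J. Math. 289 (2017) 169–187 = arXiv:1505.02628: Thm. 1.4 and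
  its proof, §4 (p. 10: "by the standard continuation method"); §3, first paragraph (local strong
  theory) and last paragraph (p. 9: "Serrin type criterion implies that `v` is regular").
  [LeiZhang2017]
* P. G. Lemarié-Rieusset, *The Navier–Stokes Problem in the 21st Century*, CRC 2016, Thm. 11.2
  ((11.11), Serrin's enstrophy inequality), Thm. 7.2 (restart). [LemarieRieusset2016]
* T. Tao, Anal. PDE 6 (2013) = arXiv:1108.1165, Thm. 5.4. [Tao2011]
-/

noncomputable section

open MeasureTheory Set Function Filter Topology
open scoped ENNReal NNReal ContDiff

namespace Literature.Analysis.FluidPDE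

/-! ### The standard continuation method in Tao's class -/

/-- **The standard continuation method** (Lei–Zhang 2017, §4, p. 10: "The above argument
implies, by the standard continuation method …"; Lemarié-Rieusset 2016, proof of Thm. 7.2/10.4:
the `H¹` norm controls the lifespan). Let `ν > 0`, `T > 0`, and let `u₀` be smooth, divergence
free and in `H^∞`. Suppose every Tao-class solution from `u₀` on a sub-slab `[0, T']`,
`0 < T' ≤ T`, satisfies the a-priori bound `∫ ‖Du(t)‖² ≤ K` for all `t ∈ [0, T']`. Then there is
a Tao-class solution from `u₀` on `[0, T]`. Proof: with `A = ∫|u₀|² + 2E(u₀) + 3∫‖Du₀‖² + 3K`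
and `τ = c ν³/(A² + 1)`, Tao's local theorem (`tao2011_smooth_local_existence_holds`) solves on
`[0, τ]` from `u₀` and from every restart datum `u(a)` (energy inequality and the a-priori bound
give `‖u(a)‖²_{H¹} ≤ A`); gluing at `a = F − τ/2` (`IsTaoSolutionOn.glue`) extends `[0, F]` to
`[0, F + τ/2]`, and induction reaches `T`. [cite: LeiZhang2017, §4 (proof of Thm. 1.4), p. 10] -/
theorem exists_isTaoSolutionOn_of_enstrophy_apriori {ν : ℝ} (hν : 0 < ν)
    {u₀ : EuclideanSpace ℝ (Fin 3) → EuclideanSpace ℝ (Fin 3)} (hsm : ContDiff ℝ ∞ u₀)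
    (hdiv : VectorCalculus.IsDivFree u₀)
    (hH : ∀ n : ℕ, ∫⁻ x, ‖iteratedFDeriv ℝ n u₀ x‖ₑ ^ 2 < ⊤) {T K : ℝ} (hT : 0 < T) (hK : 0 ≤ K)
    (hbound : ∀ ⦃T' : ℝ⦄, 0 < T' → T' ≤ T →
      ∀ ⦃u : ℝ → EuclideanSpace ℝ (Fin 3) → EuclideanSpace ℝ (Fin 3)⦄
        ⦃p : ℝ → EuclideanSpace ℝ (Fin 3) → ℝ⦄,
      IsTaoSolutionOn T' ν u₀ u p →
        ∀ t ∈ Icc 0 T', ∫⁻ x, ‖iteratedFDeriv ℝ 1 (u t) x‖ₑ ^ 2 ≤ ENNReal.ofReal K) :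
    ∃ (u : ℝ → EuclideanSpace ℝ (Fin 3) → EuclideanSpace ℝ (Fin 3))
      (p : ℝ → EuclideanSpace ℝ (Fin 3) → ℝ),
      IsTaoSolutionOn T ν u₀ u p := by
  obtain ⟨c, hc, hloc⟩ := IsTaoSolutionOn.of_tao tao2011_smooth_local_existence_holds
  /- the norms of the datum -/
  have h0 : ∫⁻ x, ‖u₀ x‖ₑ ^ 2 < ⊤ := by
    rw [lintegral_enorm_sq_eq_lintegral_iteratedFDeriv_zero]; exact hH 0
  set E₀ : ℝ := (∫⁻ x, ‖u₀ x‖ₑ ^ 2).toReal with hE₀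
  set G₀ : ℝ := (∫⁻ x, ‖iteratedFDeriv ℝ 1 u₀ x‖ₑ ^ 2).toReal with hG₀
  have hE₀0 : 0 ≤ E₀ := ENNReal.toReal_nonneg
  have hG₀0 : 0 ≤ G₀ := ENNReal.toReal_nonneg
  have hE₀le : ∫⁻ x, ‖u₀ x‖ₑ ^ 2 ≤ ENNReal.ofReal E₀ := by
    rw [hE₀, ENNReal.ofReal_toReal h0.ne]
  have hG₀le : ∫⁻ x, ‖iteratedFDeriv ℝ 1 u₀ x‖ₑ ^ 2 ≤ ENNReal.ofReal G₀ := by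
    rw [hG₀, ENNReal.ofReal_toReal (hH 1).ne]
  /- the uniform lifespan -/
  set e₀ : ℝ := 2 * VectorCalculus.kineticEnergy u₀ with he₀
  have he₀0 : 0 ≤ e₀ := mul_nonneg zero_le_two (kineticEnergy_nonneg _)
  set A : ℝ := E₀ + e₀ + 3 * G₀ + 3 * K with hAdef
  have hA0 : 0 ≤ A := by positivity
  set τ : ℝ := c * ν ^ 3 / (A ^ 2 + 1) with hτ
  have hτpos : 0 < τ := by positivity
  have hτc : A ^ 2 * τ ≤ c * ν ^ 3 := by
    calc A ^ 2 * τ = c * ν ^ 3 * (A ^ 2 / (A ^ 2 + 1)) := by rw [hτ]; ring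
      _ ≤ c * ν ^ 3 * 1 :=
          mul_le_mul_of_nonneg_left (by rw [div_le_one (by positivity)]; linarith) (by positivity)
      _ = c * ν ^ 3 := mul_one _
  have h3 : ∀ x : ℝ, ENNReal.ofReal (3 * x) = 3 * ENNReal.ofReal x := fun x => by
    rw [ENNReal.ofReal_mul (by norm_num), ENNReal.ofReal_ofNat]
  -- Tao's local solver on `[0, τ]` for data of `H¹`-size at most `A`
  have solve : ∀ a : EuclideanSpace ℝ (Fin 3) → EuclideanSpace ℝ (Fin 3), ContDiff ℝ ∞ a →
      VectorCalculus.IsDivFree a →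
      (∀ n : ℕ, ∫⁻ x, ‖iteratedFDeriv ℝ n a x‖ₑ ^ 2 < ⊤) →
      (∫⁻ x, ‖a x‖ₑ ^ 2) + (∫⁻ x, ENNReal.ofReal (frobeniusNormSq (fderiv ℝ a x))) ≤
        ENNReal.ofReal A →
      ∃ (v : ℝ → EuclideanSpace ℝ (Fin 3) → EuclideanSpace ℝ (Fin 3))
        (q : ℝ → EuclideanSpace ℝ (Fin 3) → ℝ),
        IsTaoSolutionOn τ ν a v q :=
    fun a h1 h2 h3 h4 => hloc hν hτpos h1 h2 h3 hA0 h4 hτc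
  /- base: the solution from `u₀` on `[0, τ]` -/
  have base : ∃ (v : ℝ → EuclideanSpace ℝ (Fin 3) → EuclideanSpace ℝ (Fin 3))
    (q : ℝ → EuclideanSpace ℝ (Fin 3) → ℝ),
      IsTaoSolutionOn τ ν u₀ v q := by
    refine solve u₀ hsm hdiv hH ?_
    calc (∫⁻ x, ‖u₀ x‖ₑ ^ 2) + ∫⁻ x, ENNReal.ofReal (frobeniusNormSq (fderiv ℝ u₀ x))
        ≤ ENNReal.ofReal E₀ + 3 * ENNReal.ofReal G₀ :=
          add_le_add hE₀le ((lintegral_frobeniusNormSq_le_three_mul u₀).trans (by gcongr))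
      _ = ENNReal.ofReal (E₀ + 3 * G₀) := by
          rw [ENNReal.ofReal_add hE₀0 (by positivity), h3]
      _ ≤ ENNReal.ofReal A := ENNReal.ofReal_le_ofReal (by rw [hAdef]; linarith)
  /- step: from `[0, F]`, `τ ≤ F < T`, to `[0, F + τ/2]` -/
  have step : ∀ F : ℝ, τ ≤ F → F < T →
      (∃ (v : ℝ → EuclideanSpace ℝ (Fin 3) → EuclideanSpace ℝ (Fin 3))
        (q : ℝ → EuclideanSpace ℝ (Fin 3) → ℝ),
        IsTaoSolutionOn F ν u₀ v q) →
      ∃ (v : ℝ → EuclideanSpace ℝ (Fin 3) → EuclideanSpace ℝ (Fin 3))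
        (q : ℝ → EuclideanSpace ℝ (Fin 3) → ℝ),
        IsTaoSolutionOn (F + τ / 2) ν u₀ v q := by
    rintro F hτF hFT ⟨u, p, h⟩
    have hF : 0 < F := hτpos.trans_le hτF
    -- the a-priori bound on `[0, F]`
    have hKF : ∀ t ∈ Icc 0 F, ∫⁻ x, ‖iteratedFDeriv ℝ 1 (u t) x‖ₑ ^ 2 ≤ ENNReal.ofReal K :=
      hbound hF hFT.le h
    -- restart at `a = F - τ/2`
    set a : ℝ := F - τ / 2 with ha
    have ha0 : 0 ≤ a := by rw [ha]; linarith
    have haF : a < F := by rw [ha]; linarith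
    have haI : a ∈ Icc 0 F := ⟨ha0, haF.le⟩
    obtain ⟨hsm_a, hdiv_a, hH_a⟩ := h.slice haI
    have hbd : (∫⁻ x, ‖u a x‖ₑ ^ 2) +
        (∫⁻ x, ENNReal.ofReal (frobeniusNormSq (fderiv ℝ (u a) x))) ≤ ENNReal.ofReal A := by
      calc (∫⁻ x, ‖u a x‖ₑ ^ 2) + ∫⁻ x, ENNReal.ofReal (frobeniusNormSq (fderiv ℝ (u a) x))
          ≤ ENNReal.ofReal e₀ + 3 * ENNReal.ofReal K :=
            add_le_add (h.lintegral_enorm_sq_le hF hν.le haI)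
              ((lintegral_frobeniusNormSq_le_three_mul (u a)).trans (by gcongr; exact hKF a haI))
        _ = ENNReal.ofReal (e₀ + 3 * K) := by
            rw [ENNReal.ofReal_add he₀0 (by positivity), h3]
        _ ≤ ENNReal.ofReal A := ENNReal.ofReal_le_ofReal (by rw [hAdef]; linarith)
    obtain ⟨v, q, hv⟩ := solve (u a) hsm_a hdiv_a hH_a hbd
    have hglue := h.glue hv hν hτpos ha0 haF (by rw [ha]; linarith)
    have e : a + τ = F + τ / 2 := by rw [ha]; ring
    rw [e] at hglue
    exact ⟨_, _, hglue⟩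
  /- induction: `[0, min T (τ + k τ/2)]` for every `k` -/
  have iter : ∀ k : ℕ,
      ∃ (v : ℝ → EuclideanSpace ℝ (Fin 3) → EuclideanSpace ℝ (Fin 3))
        (q : ℝ → EuclideanSpace ℝ (Fin 3) → ℝ),
      IsTaoSolutionOn (min T (τ + k * (τ / 2))) ν u₀ v q := by
    intro k
    induction k with
    | zero =>
      obtain ⟨v, q, hv⟩ := base
      refine ⟨v, q, hv.mono (lt_min hT (by positivity)) ?_⟩
      simp
    | succ k ih =>
      have hk0 : (0 : ℝ) ≤ k * (τ / 2) := by positivity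
      by_cases hFT : τ + k * (τ / 2) < T
      · -- a genuine step
        have hF : min T (τ + k * (τ / 2)) = τ + k * (τ / 2) := min_eq_right hFT.le
        rw [hF] at ih
        obtain ⟨v, q, hv⟩ := step _ (by linarith) hFT ih
        refine ⟨v, q, hv.mono (lt_min hT (by positivity)) ?_⟩
        push_cast
        linarith [min_le_right T (τ + (k + 1) * (τ / 2))]
      · -- `[0, T]` is already covered
        have hF : min T (τ + k * (τ / 2)) = T := min_eq_left (not_lt.1 hFT)
        have hF' : min T (τ + ((k + 1 : ℕ) : ℝ) * (τ / 2)) = T := by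
          refine min_eq_left ?_
          push_cast
          nlinarith [not_lt.1 hFT, hτpos.le]
        rw [hF] at ih
        rw [hF']
        exact ih
  /- conclusion -/
  obtain ⟨k, hk⟩ := exists_nat_gt (T / (τ / 2))
  have hkT : T ≤ τ + k * (τ / 2) := by
    have h1 : T < k * (τ / 2) := by
      have := (div_lt_iff₀ (by positivity : (0 : ℝ) < τ / 2)).1 hk
      linarith
    linarith
  obtain ⟨v, q, hv⟩ := iter k
  rw [min_eq_left hkT] at hv
  exact ⟨v, q, hv⟩

/-! ### The reduction of Thm. 1.4 to the a-priori enstrophy bound -/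

/-- **Lei–Zhang 2017, Thm. 1.4 (first alternative) from its a-priori enstrophy bound.**
Hypothesis `hA` (the analytic content of the printed proof, §4 with the end of §3, rendered in
Tao's smooth class): there is `δ > 0` such that for every `T > 0` and every smooth,
divergence-free, rapidly decaying, axisymmetric datum `u₀` with `Ω₀, V₀², Γ₀ ∈ L²`, `Γ₀ ∈ L^∞`
and `‖Γ₀‖_{L^∞} ≤ δ/M₀`, there is `K ≥ 0` bounding `∫ ‖Du(t)‖²` on `[0, T']` for every
Tao-class solution from `u₀` on `[0, T'] ⊆ [0, T]` with axisymmetric slices. Conclusion: the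
named fact `LeiZhang2017_smallSwirl_regularity` (with this `δ`). Proof ("standard continuation
method" + "local strong solution" + uniqueness, Lei–Zhang §4 and §3 first paragraph): the datum
`u 0` of the given classical Leray–Hopf solution is smooth, divergence free (classical solution
at `t = 0 ∈ [0, T)`), in `H^∞` (rapid decay) and axisymmetric; Tao-class solutions from it are
axisymmetric (`IsTaoSolutionOn.isAxisymmetric`), so `hA` and
`exists_isTaoSolutionOn_of_enstrophy_apriori` give a Tao-class solution `(v, q)` on
`[0, T + 1]`; by Prodi–Serrin weak–strong uniqueness (`eq_restart_of_serrin` with the proved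
`serrin_weak_strong_uniqueness_holds`) `u = v` on `[0, T)`, so `(v, q)` restricted to
`[0, T + 1)` is a smooth extension of `u` past `T`. [cite: LeiZhang2017, Thm. 1.4 and its proof §4 (p. 10), §3 first paragraph (p. 8)] -/
theorem LeiZhang2017_smallSwirl_regularity_of_enstrophy_apriori {δ : ℝ} (hδ : 0 < δ)
    (hA : ∀ ⦃T : ℝ⦄, 0 < T → ∀ ⦃u₀ : EuclideanSpace ℝ (Fin 3) → EuclideanSpace ℝ (Fin 3)⦄,
      ContDiff ℝ ∞ u₀ → VectorCalculus.IsDivFree u₀ →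
      HasRapidSpatialDecay u₀ → (∀ n : ℕ, ∫⁻ x, ‖iteratedFDeriv ℝ n u₀ x‖ₑ ^ 2 < ⊤) →
      IsAxisymmetric u₀ →
      eLpNorm (LeiZhang2017.bigOmega u₀) 2 volume < ⊤ →
      eLpNorm (LeiZhang2017.vSq u₀) 2 volume < ⊤ →
      eLpNorm (swirl u₀) 2 volume < ⊤ → eLpNorm (swirl u₀) ∞ volume < ⊤ →
      eLpNorm (swirl u₀) ∞ volume ≤ ENNReal.ofReal δ / LeiZhang2017.M0 u₀ →
      ∃ K : ℝ, 0 ≤ K ∧ ∀ ⦃T' : ℝ⦄, 0 < T' → T' ≤ T →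
        ∀ ⦃u : ℝ → EuclideanSpace ℝ (Fin 3) → EuclideanSpace ℝ (Fin 3)⦄
          ⦃p : ℝ → EuclideanSpace ℝ (Fin 3) → ℝ⦄,
          IsTaoSolutionOn T' 1 u₀ u p →
          (∀ t ∈ Icc 0 T', IsAxisymmetric (u t)) →
          ∀ t ∈ Icc 0 T', ∫⁻ x, ‖iteratedFDeriv ℝ 1 (u t) x‖ₑ ^ 2 ≤ ENNReal.ofReal K) :
    LeiZhang2017_smallSwirl_regularity := by
  refine ⟨δ, hδ, ?_⟩
  intro T u p hT hcl hLH hdec haxi hΩ hV hΓ2 hΓi hsmall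
  -- the datum
  have h0T : (0 : ℝ) ∈ Ico 0 T := ⟨le_rfl, hT⟩
  have hsm : ContDiff ℝ ∞ (u 0) := hcl.contDiff_velocity h0T
  have hdiv : VectorCalculus.IsDivFree (u 0) := hcl.divFree 0 h0T
  have hH : ∀ n : ℕ, ∫⁻ x, ‖iteratedFDeriv ℝ n (u 0) x‖ₑ ^ 2 < ⊤ :=
    hdec.lintegral_enorm_iteratedFDeriv_sq_lt_top
  have haxi0 : IsAxisymmetric (u 0) := haxi 0 h0T
  -- the a-priori bound on `[0, T + 1]`, for all Tao-class solutions from `u 0`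
  have hT1 : 0 < T + 1 := by linarith
  obtain ⟨K, hK, hbound⟩ := hA hT1 hsm hdiv hdec hH haxi0 hΩ hV hΓ2 hΓi hsmall
  have hbound' : ∀ ⦃T' : ℝ⦄, 0 < T' → T' ≤ T + 1 →
      ∀ ⦃v : ℝ → EuclideanSpace ℝ (Fin 3) → EuclideanSpace ℝ (Fin 3)⦄
        ⦃q : ℝ → EuclideanSpace ℝ (Fin 3) → ℝ⦄,
      IsTaoSolutionOn T' 1 (u 0) v q →
        ∀ t ∈ Icc 0 T', ∫⁻ x, ‖iteratedFDeriv ℝ 1 (v t) x‖ₑ ^ 2 ≤ ENNReal.ofReal K :=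
    fun T' hT' hT'T v q hv => hbound hT' hT'T hv (hv.isAxisymmetric one_pos hT' haxi0)
  -- a Tao-class solution on `[0, T + 1]`
  obtain ⟨v, q, hv⟩ :=
    exists_isTaoSolutionOn_of_enstrophy_apriori one_pos hsm hdiv hH hT1 hK hbound'
  -- identification with `u` on `[0, T)` by Prodi–Serrin weak–strong uniqueness
  have hLH' : IsLerayHopfOn (T - 0) 1 0 (u 0) (fun t => u (t + 0)) := by simpa using hLH
  have heq := eq_restart_of_serrin serrin_weak_strong_uniqueness_holds one_pos hT1 le_rfl hT hcl
    hLH' hv.classical hv.initial hv.sobolev hv.sobolev_p hv.continuousL2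
  refine ⟨T + 1, by linarith, v, q,
    hv.classical.mono Ico_subset_Icc_self (uniqueDiffOn_Ico 0 (T + 1)), fun t ht => ?_⟩
  have ht' : t ∈ Ico 0 (min (T + 1) (T - 0)) :=
    ⟨ht.1, lt_min (by linarith [ht.2]) (by simpa using ht.2)⟩
  simpa using (heq t ht').symm


/-! ### "Serrin type criterion": the enstrophy bound from a uniform `L⁴` bound -/

/-- Serrin's exponent for `r = 4`: `q = 2/(1 − 3/4) = 8`. [folklore] -/
theorem serrin_exponent_four : (2 / (1 - (3 / (4 : ℝ≥0∞)).toReal) : ℝ) = 8 := by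
  rw [ENNReal.toReal_div, ENNReal.toReal_ofNat, ENNReal.toReal_ofNat]; norm_num

/-- **"`v ∈ L^∞_T(L⁴_x)`, so Serrin type criterion implies that `v` is regular"** (Lei–Zhang 2017,
end of §3, p. 9), in a-priori form in Tao's smooth class: there is an absolute `C ≥ 0` such that
for every Tao-class solution `(u, p)` on `[0, T] × ℝ³` (`ν > 0`) from `u₀` with
`‖u(t)‖_{L⁴} ≤ N` for all `t ∈ [0, T]`, one has
`∫ ‖Du(s)‖² ≤ 3 exp(C ν⁻⁷ T N⁸) ∫ ‖Du₀‖²` for all `s ∈ [0, T]` — Serrin's enstrophy inequality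
`‖∇u(s)‖²₂ ≤ ‖∇u(0)‖²₂ exp(C ν^{1−q} ∫₀ˢ ‖u‖_{L^r}^q)` (Lemarié-Rieusset 2016, Thm. 11.2, (11.11);
the tree's `serrin_enstrophy_bound`) at `(r, q) = (4, 8)`, with `∫₀ˢ ‖u‖₄⁸ ≤ T N⁸` and the
comparison `‖Du‖² ≤ |∇u|²_F ≤ 3‖Du‖²` between operator and Frobenius norms. [cite: LeiZhang2017, §3, last paragraph (p. 9)] -/
theorem exists_enstrophy_bound_of_eLpNorm_four_le :
    ∃ C : ℝ, 0 ≤ C ∧ ∀ ⦃ν T : ℝ⦄, 0 < ν → 0 < T →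
      ∀ ⦃u₀ : EuclideanSpace ℝ (Fin 3) → EuclideanSpace ℝ (Fin 3)⦄
        ⦃u : ℝ → EuclideanSpace ℝ (Fin 3) → EuclideanSpace ℝ (Fin 3)⦄
        ⦃p : ℝ → EuclideanSpace ℝ (Fin 3) → ℝ⦄, IsTaoSolutionOn T ν u₀ u p →
      ∀ ⦃N : ℝ⦄, 0 ≤ N → (∀ t ∈ Icc 0 T, eLpNorm (u t) 4 volume ≤ ENNReal.ofReal N) →
      ∀ s ∈ Icc 0 T, ∫⁻ x, ‖iteratedFDeriv ℝ 1 (u s) x‖ₑ ^ 2 ≤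
        ENNReal.ofReal (3 * Real.exp (C * ν ^ (-7 : ℝ) * (T * N ^ 8))) *
          ∫⁻ x, ‖iteratedFDeriv ℝ 1 u₀ x‖ₑ ^ 2 := by
  obtain ⟨C, hC0, hC⟩ := serrin_enstrophy_bound (r := 4) (by norm_num)
  refine ⟨C, hC0, ?_⟩
  intro ν T hν hT u₀ u p h N hN hN4 s hs
  have h8 : (2 / (1 - (3 / (4 : ℝ≥0∞)).toReal) : ℝ) = 8 := serrin_exponent_four
  -- operator norm versus Frobenius norm, pointwise
  have hpt : ∀ (w : EuclideanSpace ℝ (Fin 3) → EuclideanSpace ℝ (Fin 3))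
      (x : EuclideanSpace ℝ (Fin 3)),
      ‖iteratedFDeriv ℝ 1 w x‖ₑ ^ 2 ≤ ENNReal.ofReal (frobeniusNormSq (fderiv ℝ w x)) := by
    intro w x
    rw [← ofReal_norm, norm_iteratedFDeriv_one, ofReal_norm]
    exact enorm_sq_fderiv_le_ofReal_frobeniusNormSq _
  have hνC : 0 ≤ C * ν ^ (-7 : ℝ) := mul_nonneg hC0 (Real.rpow_nonneg hν.le _)
  have hexp1 : 1 ≤ Real.exp (C * ν ^ (-7 : ℝ) * (T * N ^ 8)) :=
    Real.one_le_exp (mul_nonneg hνC (by positivity))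
  have h3 : ENNReal.ofReal (3 * Real.exp (C * ν ^ (-7 : ℝ) * (T * N ^ 8))) =
      ENNReal.ofReal (Real.exp (C * ν ^ (-7 : ℝ) * (T * N ^ 8))) * 3 := by
    rw [mul_comm, ENNReal.ofReal_mul (Real.exp_pos _).le, ENNReal.ofReal_ofNat]
  rcases hs.1.eq_or_lt with h0 | h0
  · -- `s = 0`: nothing to prove beyond `1 ≤ 3 exp(…)`
    rw [← h0, h.initial]
    calc ∫⁻ x, ‖iteratedFDeriv ℝ 1 u₀ x‖ₑ ^ 2 = 1 * ∫⁻ x, ‖iteratedFDeriv ℝ 1 u₀ x‖ₑ ^ 2 :=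
          (one_mul _).symm
      _ ≤ ENNReal.ofReal (3 * Real.exp (C * ν ^ (-7 : ℝ) * (T * N ^ 8))) *
            ∫⁻ x, ‖iteratedFDeriv ℝ 1 u₀ x‖ₑ ^ 2 := by
          gcongr
          rw [← ENNReal.ofReal_one]
          exact ENNReal.ofReal_le_ofReal (by nlinarith)
  · have hsI : s ∈ Ioc 0 T := ⟨h0, hs.2⟩
    -- the Serrin integral `∫₀ˢ ‖u‖₄⁸` is at most `T N⁸`
    have hint : ∫⁻ t in Ioo 0 s, ENNReal.ofReal
        ((eLpNorm (u t) 4 volume).toReal ^ (2 / (1 - (3 / (4 : ℝ≥0∞)).toReal))) ≤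
        ENNReal.ofReal (T * N ^ 8) := by
      rw [h8]
      calc ∫⁻ t in Ioo 0 s, ENNReal.ofReal ((eLpNorm (u t) 4 volume).toReal ^ (8 : ℝ))
          ≤ ∫⁻ _ in Ioo 0 s, ENNReal.ofReal (N ^ 8) := by
            refine setLIntegral_mono' measurableSet_Ioo fun t ht => ENNReal.ofReal_le_ofReal ?_
            have hle : (eLpNorm (u t) 4 volume).toReal ≤ N := by
              have h1 := hN4 t ⟨ht.1.le, ht.2.le.trans hs.2⟩
              have h2 := ENNReal.toReal_mono ENNReal.ofReal_ne_top h1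
              rwa [ENNReal.toReal_ofReal hN] at h2
            calc (eLpNorm (u t) 4 volume).toReal ^ (8 : ℝ)
                = (eLpNorm (u t) 4 volume).toReal ^ (8 : ℕ) := by
                  rw [← Real.rpow_natCast]; norm_num
              _ ≤ N ^ 8 := pow_le_pow_left₀ ENNReal.toReal_nonneg hle 8
        _ = ENNReal.ofReal (N ^ 8) * volume (Ioo 0 s) := setLIntegral_const _ _
        _ = ENNReal.ofReal (N ^ 8) * ENNReal.ofReal s := by rw [Real.volume_Ioo, sub_zero]
        _ = ENNReal.ofReal (N ^ 8 * s) := (ENNReal.ofReal_mul (by positivity)).symm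
        _ ≤ ENNReal.ofReal (T * N ^ 8) :=
            ENNReal.ofReal_le_ofReal (by nlinarith [hs.2, pow_nonneg hN 8])
    have hfin : ∫⁻ t in Ioo 0 s, ENNReal.ofReal
        ((eLpNorm (u t) 4 volume).toReal ^ (2 / (1 - (3 / (4 : ℝ≥0∞)).toReal))) ≠ ⊤ :=
      (hint.trans_lt ENNReal.ofReal_lt_top).ne
    have hser := hC hν hT h.classical h.sobolev h.sobolev_dt h.sobolev_p hsI hfin
    -- the exponential factor
    have hν7 : ν ^ (1 - 2 / (1 - (3 / (4 : ℝ≥0∞)).toReal)) = ν ^ (-7 : ℝ) := by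
      rw [h8]; norm_num
    have hexp : Real.exp (C * ν ^ (1 - 2 / (1 - (3 / (4 : ℝ≥0∞)).toReal)) *
        (∫⁻ t in Ioo 0 s, ENNReal.ofReal
          ((eLpNorm (u t) 4 volume).toReal ^ (2 / (1 - (3 / (4 : ℝ≥0∞)).toReal)))).toReal) ≤
        Real.exp (C * ν ^ (-7 : ℝ) * (T * N ^ 8)) := by
      rw [hν7]
      refine Real.exp_le_exp.2 (mul_le_mul_of_nonneg_left ?_ hνC)
      have h2 := ENNReal.toReal_mono ENNReal.ofReal_ne_top hint
      rwa [ENNReal.toReal_ofReal (by positivity)] at h2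
    calc ∫⁻ x, ‖iteratedFDeriv ℝ 1 (u s) x‖ₑ ^ 2
        ≤ ∫⁻ x, ENNReal.ofReal (frobeniusNormSq (fderiv ℝ (u s) x)) := lintegral_mono (hpt (u s))
      _ ≤ ENNReal.ofReal (Real.exp (C * ν ^ (-7 : ℝ) * (T * N ^ 8))) *
            ∫⁻ x, ENNReal.ofReal (frobeniusNormSq (fderiv ℝ (u 0) x)) :=
          hser.trans (by gcongr)
      _ ≤ ENNReal.ofReal (Real.exp (C * ν ^ (-7 : ℝ) * (T * N ^ 8))) *
            (3 * ∫⁻ x, ‖iteratedFDeriv ℝ 1 u₀ x‖ₑ ^ 2) := by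
          rw [h.initial]
          gcongr
          exact lintegral_frobeniusNormSq_le_three_mul u₀
      _ = ENNReal.ofReal (3 * Real.exp (C * ν ^ (-7 : ℝ) * (T * N ^ 8))) *
            ∫⁻ x, ‖iteratedFDeriv ℝ 1 u₀ x‖ₑ ^ 2 := by
          rw [h3]
          exact (mul_assoc _ _ _).symm

/-- **Lei–Zhang 2017, Thm. 1.4 (first alternative) from its a-priori `L⁴` bound.** Hypothesis
`hA` (the printed a-priori estimate of §4 carried to "`v ∈ L^∞_T(L⁴_x)`", end of §3, p. 9,
rendered in Tao's smooth class): for the given `δ > 0`, every `T > 0` and every smooth,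
divergence-free, rapidly decaying, axisymmetric datum `u₀` with `Ω₀, V₀², Γ₀ ∈ L²`,
`Γ₀ ∈ L^∞`, `‖Γ₀‖_{L^∞} ≤ δ/M₀`, there is `N ≥ 0` with `‖u(t)‖_{L⁴} ≤ N` on `[0, T']` for every
Tao-class solution from `u₀` on `[0, T'] ⊆ [0, T]` with axisymmetric slices. Conclusion: the
named fact. Proof: the `L⁴` bound gives the enstrophy bound
(`exists_enstrophy_bound_of_eLpNorm_four_le`, "Serrin type criterion"), and
`LeiZhang2017_smallSwirl_regularity_of_enstrophy_apriori` concludes. [cite: LeiZhang2017, Thm. 1.4, proof §4 (p. 10) with §3 last paragraph (p. 9)] -/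
theorem LeiZhang2017_smallSwirl_regularity_of_L4_apriori {δ : ℝ} (hδ : 0 < δ)
    (hA : ∀ ⦃T : ℝ⦄, 0 < T → ∀ ⦃u₀ : EuclideanSpace ℝ (Fin 3) → EuclideanSpace ℝ (Fin 3)⦄,
      ContDiff ℝ ∞ u₀ → VectorCalculus.IsDivFree u₀ →
      HasRapidSpatialDecay u₀ → (∀ n : ℕ, ∫⁻ x, ‖iteratedFDeriv ℝ n u₀ x‖ₑ ^ 2 < ⊤) →
      IsAxisymmetric u₀ →
      eLpNorm (LeiZhang2017.bigOmega u₀) 2 volume < ⊤ →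
      eLpNorm (LeiZhang2017.vSq u₀) 2 volume < ⊤ →
      eLpNorm (swirl u₀) 2 volume < ⊤ → eLpNorm (swirl u₀) ∞ volume < ⊤ →
      eLpNorm (swirl u₀) ∞ volume ≤ ENNReal.ofReal δ / LeiZhang2017.M0 u₀ →
      ∃ N : ℝ, 0 ≤ N ∧ ∀ ⦃T' : ℝ⦄, 0 < T' → T' ≤ T →
        ∀ ⦃u : ℝ → EuclideanSpace ℝ (Fin 3) → EuclideanSpace ℝ (Fin 3)⦄
          ⦃p : ℝ → EuclideanSpace ℝ (Fin 3) → ℝ⦄,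
          IsTaoSolutionOn T' 1 u₀ u p →
          (∀ t ∈ Icc 0 T', IsAxisymmetric (u t)) →
          ∀ t ∈ Icc 0 T', eLpNorm (u t) 4 volume ≤ ENNReal.ofReal N) :
    LeiZhang2017_smallSwirl_regularity := by
  obtain ⟨C, hC0, hC⟩ := exists_enstrophy_bound_of_eLpNorm_four_le
  refine LeiZhang2017_smallSwirl_regularity_of_enstrophy_apriori hδ ?_
  intro T hT u₀ hsm hdiv hdec hH haxi hΩ hV hΓ2 hΓi hsmall
  obtain ⟨N, hN, hN4⟩ := hA hT hsm hdiv hdec hH haxi hΩ hV hΓ2 hΓi hsmall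
  set G : ℝ := (∫⁻ x, ‖iteratedFDeriv ℝ 1 u₀ x‖ₑ ^ 2).toReal with hG
  have hGeq : ∫⁻ x, ‖iteratedFDeriv ℝ 1 u₀ x‖ₑ ^ 2 = ENNReal.ofReal G := by
    rw [hG, ENNReal.ofReal_toReal (hH 1).ne]
  refine ⟨3 * Real.exp (C * (T * N ^ 8)) * G, by positivity, ?_⟩
  intro T' hT' hT'T u p h haxiu t ht
  have h1 := hC one_pos hT' h hN (hN4 hT' hT'T h haxiu) t ht
  rw [Real.one_rpow, mul_one] at h1
  calc ∫⁻ x, ‖iteratedFDeriv ℝ 1 (u t) x‖ₑ ^ 2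
      ≤ ENNReal.ofReal (3 * Real.exp (C * (T' * N ^ 8))) * ∫⁻ x, ‖iteratedFDeriv ℝ 1 u₀ x‖ₑ ^ 2 :=
        h1
    _ ≤ ENNReal.ofReal (3 * Real.exp (C * (T * N ^ 8))) * ENNReal.ofReal G := by
        rw [hGeq]
        gcongr
    _ = ENNReal.ofReal (3 * Real.exp (C * (T * N ^ 8)) * G) :=
        (ENNReal.ofReal_mul (by positivity)).symm

end Literature.Analysis.FluidPDE

end
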